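import Literature.AlgebraicGeometry.HodgeTheory.HodgeModelExistence
import Literature.AlgebraicGeometry.Motives.GAGA
import Literature.AlgebraicGeometry.Motives.HodgeDecomposition
import Literature.AlgebraicGeometry.Motives.VarietiesProperProofs
import Literature.AlgebraicGeometry.Motives.AlgPointsProperProofs
import Literature.NumberTheory.Transcendental.AnalytificationExistenceProofs
import HarnessLib

/-!
# Smooth projective complex varieties have Hodge models (proof file: assembly)

This file proves the ASSEMBLY step of the named fact
`Literature.AlgebraicGeometry.HodgeTheory.nonempty_hodgeModel` (`HodgeModelExistence.lean`):
`nonempty_hodgeModel n X` — a smooth projective `X/ℂ` of dimension `n` has a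
`HodgeTheory.HodgeModel n X` — is reduced (`nonempty_hodgeModel_of`) to exactly three named facts
of the tree, each a published theorem carried with its own citation,

* (3) de Rham's theorem with complex coefficients, as a natural isomorphism family over the
  manifolds charted on `ℂⁿ`: `Literature.NumberTheory.Transcendental.exists_complexDeRhamIsoFamily
  (Fin n → ℂ)` [cite: WellsDACM1980, Thm. III.4.13];
* (4a) the analytification of a smooth `X ↪ ℙᴺ` is a Kähler manifold (restriction of the
  Fubini–Study metric):
  `Literature.AlgebraicGeometry.Motives.isKaehlerManifold_of_isAnalytification_of_isClosedImmersion`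
  [cite: VoisinHodgeI2002, §3.3.2];
* (4b) the Hodge decomposition `H^k_dR(M; ℂ) = ⨁_{p+q=k} K^{p,q}` of a compact Kähler manifold:
  `Literature.AlgebraicGeometry.Motives.isInternal_hodgePQ` [cite: VoisinHodgeI2002, §6.1.3 Prop. 6.11],

everything else being PROVED in the tree and assembled here:

* (1) the analytification `φ : M → X(ℂ)` with a holomorphic atlas on `ℂⁿ`, `M` Hausdorff —
  `Literature.NumberTheory.Transcendental.exists_isAnalytification_holds X n` (Serre, GAGA §2 n°5
  Prop. 2: «Il existe sur `X` une structure d'espace analytique et une seule telle que … toute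
  carte algébrique [soit] une carte analytique», Hausdorff by `(VA_II)`), whose hypotheses
  `[LocallyOfFiniteType X.hom] [IsSeparated X.hom]` come from properness,
  `Literature.AlgebraicGeometry.Motives.IsSmoothProjective.isProper_holds` (Hartshorne II.4.9);
* (2) `X(ℂ)` compact for `X` proper —
  `Literature.AlgebraicGeometry.Motives.compactSpace_algPoints_of_isProper_holds X ℂ` (Serre, GAGA
  §2 n°7 Prop. 6: «Pour qu'une variété algébrique `X` soit complète, il faut et il suffit qu'elle
  soit compacte»; SGA1 XII Prop. 3.2 (v)), transported along the homeomorphism `φ`; σ-compactness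
  follows (Serre, loc. cit. n°5: «`X^h` est un espace localement compact dénombrable à l'infini»);
* (2') the real `C^∞` structure underlying the holomorphic atlas —
  `Literature.Geometry.Kaehler.isManifold_real_of_isManifold_complex`.

`HodgeModel.nonempty_of_isAnalytification` packages (2') and σ-compactness: a Hodge model is
given by a compact Hausdorff analytification with holomorphic atlas, a natural complex de Rham
family on its model space, and the Hodge decomposition on it.

Discharging (3), (4a), (4b) (each a separate programme: de Rham's theorem needs the Poincaré
lemma, Mayer–Vietoris on both sides and the smooth-singular comparison; (4b) needs the Hodge
theorem on harmonic forms, i.e. elliptic theory on compact manifolds; (4a) needs the Fubini–Study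
metric `isKaehlerManifold_projectivization` and functoriality of the analytification) then yields
`nonempty_hodgeModel_holds := nonempty_hodgeModel_of ‹3› ‹4a› ‹4b›` with no further work.

## References

* J.-P. Serre, *Géométrie algébrique et géométrie analytique*, Ann. Inst. Fourier 6 (1956), §2
  n°5 (Lemme 1, Prop. 2), n°7 (Prop. 6). (Held: `paper:doi-10-5802-aif-59`, PDF pp. 9–13.)
* A. Grothendieck, M. Raynaud, *SGA 1*, Exp. XII, Prop. 3.1, Prop. 3.2.
* R. O. Wells, *Differential Analysis on Complex Manifolds* (1980), Thm. III.4.13.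
* C. Voisin, *Hodge Theory and Complex Algebraic Geometry I* (2002), §3.3.2, §6.1.3 (Prop. 6.11).
* R. Hartshorne, *Algebraic Geometry* (1977), II Thm. 4.9.
-/

noncomputable section

open scoped Manifold ContDiff

namespace Literature.AlgebraicGeometry.HodgeTheory

section HodgeTheory

variable {n : ℕ} {X : Motives.SchemeOver ℂ}

namespace HodgeModel

variable (n X) in
/-- **Hodge models from analytifications.** A compact Hausdorff complex manifold `M` with
holomorphic atlas on the finite-dimensional model `E`, exhibited by `φ : M → X(ℂ)` as the
analytification of `X` (relative dimension `n`), together with a natural complex de Rham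
isomorphism family on the manifolds charted on `E` and the Hodge decomposition
`H^k_dR(M; ℂ) = ⨁_{p+q=k} K^{p,q}` of `M`, gives a Hodge model of `X`: the real `C^∞` structure is
the one underlying the holomorphic atlas (`Literature.Geometry.Kaehler.isManifold_real_of_isManifold_complex`,
Wells Ch. I §3) and σ-compactness follows from compactness (Serre, GAGA §2 n°5: `X^h` is
«localement compact dénombrable à l'infini»). [cite: SerreGAGA1956, §2 n°5 Prop. 2]
[cite: WellsDACM1980, Thm. III.4.13] [cite: VoisinHodgeI2002, §6.1.3 Prop. 6.11] -/
theorem nonempty_of_isAnalytification (E : Type) [NormedAddCommGroup E] [NormedSpace ℂ E]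
    [FiniteDimensional ℂ E] (M : Type) [TopologicalSpace M] [ChartedSpace E M]
    [IsManifold 𝓘(ℂ, E) ω M] [T2Space M] [CompactSpace M] (φ : M → Motives.ComplexPoints X)
    (hφ : Literature.NumberTheory.Transcendental.IsAnalytification E X n φ)
    (e : Literature.NumberTheory.Transcendental.ComplexDeRhamIsoFamily E) (he : e.IsNatural)
    (hH : ∀ k : ℕ, DirectSum.IsInternal fun pq : ↥(Finset.antidiagonal k) ↦
      Literature.NumberTheory.Transcendental.hodgePQ E M k pq.1.1 pq.1.2) :
    Nonempty (HodgeModel n X) :=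
  haveI := Literature.Geometry.Kaehler.isManifold_real_of_isManifold_complex (E := E) (M := M)
  ⟨{ model := E
     carrier := M
     toComplexPoints := φ
     isAnalytification := hφ
     deRham := e
     deRham_isNatural := he
     isInternal_hodgePQ := hH }⟩

end HodgeModel

/-- The complex points `X(ℂ)` of a smooth projective variety over `ℂ` form a compact space
(`X → Spec ℂ` is proper, Hartshorne II.4.9, `IsSmoothProjective.isProper_holds`; proper ⇒ `X(ℂ)`
compact, Serre, GAGA §2 n°7 Prop. 6 / SGA1 XII Prop. 3.2 (v),
`compactSpace_algPoints_of_isProper_holds`). [cite: SerreGAGA1956, §2 n°7 Prop. 6]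
[cite: SGA1, Exp. XII Prop. 3.2 (v)] -/
theorem compactSpace_complexPoints_of_isSmoothProjective (hX : Motives.IsSmoothProjective n X) :
    CompactSpace (Motives.ComplexPoints X) :=
  haveI : AlgebraicGeometry.IsProper X.hom := Motives.IsSmoothProjective.isProper_holds hX
  Motives.compactSpace_algPoints_of_isProper_holds X ℂ

/-- **Existence of the analytification of a smooth projective complex variety, with its
topological properties** (Serre, GAGA §2 n°5 Prop. 2 and n°7 Prop. 6; SGA1 XII Thm. 1.1,
Prop. 3.1, Prop. 3.2): a smooth projective `X/ℂ` of dimension `n` has an analytification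
`φ : M → X(ℂ)` which is a compact Hausdorff complex manifold with holomorphic atlas on `ℂⁿ`.
Assembled from the tree's proved `exists_isAnalytification_holds` (smooth, separated, locally of
finite type — the last two because `X → Spec ℂ` is proper, `IsSmoothProjective.isProper_holds`)
and `compactSpace_complexPoints_of_isSmoothProjective` transported along the homeomorphism `φ`.
[cite: SerreGAGA1956, §2 n°5 Prop. 2 and n°7 Prop. 6] [cite: SGA1, Exp. XII Thm. 1.1] -/
theorem exists_compact_isAnalytification_of_isSmoothProjective
    (hX : Motives.IsSmoothProjective n X) :
    ∃ (M : Type) (_ : TopologicalSpace M) (_ : T2Space M) (_ : CompactSpace M)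
      (_ : ChartedSpace (Fin n → ℂ) M) (_ : IsManifold 𝓘(ℂ, Fin n → ℂ) ω M)
      (φ : M → Motives.ComplexPoints X),
      Literature.NumberTheory.Transcendental.IsAnalytification (Fin n → ℂ) X n φ := by
  haveI : AlgebraicGeometry.IsProper X.hom := Motives.IsSmoothProjective.isProper_holds hX
  haveI : AlgebraicGeometry.SmoothOfRelativeDimension n X.hom := hX.smoothOfRelativeDimension
  obtain ⟨M, _, _, _, _, φ, hφ⟩ :=
    Literature.NumberTheory.Transcendental.exists_isAnalytification_holds X n
  haveI : CompactSpace (Motives.ComplexPoints X) :=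
    compactSpace_complexPoints_of_isSmoothProjective hX
  haveI : CompactSpace M := hφ.homeomorph.symm.compactSpace
  exact ⟨M, _, ‹_›, ‹_›, _, ‹_›, φ, hφ⟩

/-- **Reduction of the named fact `nonempty_hodgeModel n X` to three named facts of the
tree.** If (3) de Rham's theorem with complex coefficients holds as a natural isomorphism family
over the manifolds charted on `ℂⁿ` (`exists_complexDeRhamIsoFamily (Fin n → ℂ)`, Wells
Thm. III.4.13), (4a) analytifications of the smooth projective `X` are Kähler
(`isKaehlerManifold_of_isAnalytification_of_isClosedImmersion`, Voisin I §3.3.2: restriction of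
the Fubini–Study metric), and (4b) compact Kähler manifolds have the Hodge decomposition
`H^k_dR = ⨁_{p+q=k} K^{p,q}` (`isInternal_hodgePQ`, Voisin I §6.1.3 Prop. 6.11), then every smooth
projective `X/ℂ` of dimension `n` has a Hodge model: take the analytification `X^an → X(ℂ)` of
Serre (GAGA §2 n°5 Prop. 2; compact by n°7 Prop. 6, Hausdorff by `(VA_II)`), proved in the tree
(`exists_compact_isAnalytification_of_isSmoothProjective`), with the real `C^∞` structure
underlying its holomorphic atlas, the family (3), and the decomposition (4b) for the Kähler
structure (4a) given by a projective embedding `X ↪ ℙᴺ_ℂ` (`IsSmoothProjective.isProjectiveOver`).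
Hypotheses (4a), (4b) are quantified over all manifolds (in universe `0`) because the carrier is
produced by an existential; they are fed verbatim by the facts' future `_holds` theorems.
[cite: SerreGAGA1956, §2 n°5 Prop. 2 and n°7 Prop. 6] [cite: WellsDACM1980, Thm. III.4.13]
[cite: VoisinHodgeI2002, §3.3.2 and §6.1.3 Prop. 6.11] -/
theorem nonempty_hodgeModel_of
    (h3 : Literature.NumberTheory.Transcendental.exists_complexDeRhamIsoFamily (Fin n → ℂ))
    (h4a : ∀ (E : Type) [NormedAddCommGroup E] [NormedSpace ℂ E] [FiniteDimensional ℂ E]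
      (M : Type) [TopologicalSpace M] [ChartedSpace E M] (φ : M → Motives.ComplexPoints X),
      Motives.isKaehlerManifold_of_isAnalytification_of_isClosedImmersion
        (X := X) (d := n) (E := E) (M := M) (φ := φ))
    (h4b : ∀ (E : Type) [NormedAddCommGroup E] [NormedSpace ℂ E] [FiniteDimensional ℂ E]
      (M : Type) [TopologicalSpace M] [ChartedSpace E M] [IsManifold 𝓘(ℝ, E) ∞ M],
      Motives.isInternal_hodgePQ (E := E) (M := M)) :
    nonempty_hodgeModel n X := by
  intro hX
  obtain ⟨M, _, _, _, _, _, φ, hφ⟩ := exists_compact_isAnalytification_of_isSmoothProjective hX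
  haveI : AlgebraicGeometry.SmoothOfRelativeDimension n X.hom := hX.smoothOfRelativeDimension
  haveI := Literature.Geometry.Kaehler.isManifold_real_of_isManifold_complex (E := Fin n → ℂ) (M := M)
  obtain ⟨N, ι, hι⟩ := hX.isProjectiveOver
  haveI : Literature.Geometry.Kaehler.IsKaehlerManifold (Fin n → ℂ) M := h4a (Fin n → ℂ) M φ ι hφ
  obtain ⟨e, he⟩ := h3
  exact HodgeModel.nonempty_of_isAnalytification n X (Fin n → ℂ) M φ hφ e he fun k ↦
    h4b (Fin n → ℂ) M k

end HodgeTheory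

end Literature.AlgebraicGeometry.HodgeTheory

end
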